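import Summits.Ventures.Crystal3D.Theorems.StickyWulffConstantCoaxialWallLawPayerInstanceMultiExcl
import Summits.Ventures.Crystal3D.Theorems.StickyWulffConstantCoaxialWallLawWordNoTop
import Summits.Ventures.Crystal3D.Theorems.StickyWulffConstantCoaxialWallLawTriadic
import Summits.Ventures.Crystal3D.Theorems.StickyWulffConstantCoaxialWallLawSources
import Summits.Ventures.Crystal3D.Theorems.StickyWulffConstantCoaxialWallLawBandCount
import Summits.Ventures.Crystal3D.Theorems.StickyWulffConstantCoaxialWallLawTwinFrames
import Summits.Ventures.Crystal3D.Theorems.StickyWulffConstantNoReconstructionGainSymmetry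
import HarnessLib

/-!
# End accounting, census-free, multi-source V: the co-axial TWIN cell sourced from ALL rising in-plane slots —
# payers ≥ (√2·(Σ_r α_r)·π ρ² − O(ρ))/78

HONEST FRAMING. Part of the venture `Summits/Ventures/Crystal3D` (cell `crystal3d-full`), helper
`--supports` the crux `CoaxialWallLaw` (stmt-Ventures-19481, `route-Ventures-StickyWulffConstant`),
REGISTERED line `WallLedgerF` (planner cf-p1), open stub `stub_coaxialTwoSlabAdhesion`.
Rung credit only; F-C1 not moved.  Brick (B5a) of memo HOME/wall-19481-p2/F-MULTISOURCE.md (19481-p2 g4): the text of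
19481-p1's `wordNet_twin_payers_ge_censusFree` (`…PayerCell`, ONE in-plane root slot) with the in-plane word automaton run
from EVERY rising in-plane slot `r` of the bottom frame at once (`word_sources_le_lists_payers_multiExcl`,
`…PayerInstanceMultiExcl`: each root's words never carry a triangle of the top frame — `word_noTop_of_inner_zero` —, the
end pairs of different roots are disjoint by LEMMA X, and all fit the one family-blind capacity `78·#PAY`).
INPUTS BY NAME: `KissingGap δ`, `KissingClassification δ` ONLY.

**Theorem (`wordNet_twin_payers_ge_multi`).**  Normal-form twin frames `F false, F true` over a Barlow frame `L`, axis
`n = ±L e₃`, grains `F false·Λ₀ + s₁` (bottom), `F true·Λ₀ + s₂` (top), the two-slab cell; `RT` = the rising IN-PLANE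
slots of the bottom frame (`⟪F false r, n⟫ = 0`, `(F false r)₂ > 0`):
`√2 · (Σ_{r ∈ RT} (F false r)₂) · π ρ² − 12·(12√2π + 36R₀ + 55440) ρ ≤ 78 · #{z ∈ X : deg z ≤ 11, −R₀−2 ≤ z₂ ≤ h+R₀+2}`.
The three rising in-plane slots carry TWICE the rise of the sharp one (`Σ = 2·max`), so the twin constant `√6/312`
becomes `√6/156` in the assembly brick.

WHAT THIS IS NOT: not the stub; the assembly is the next brick; F-C1 not moved.
-/
noncomputable section

namespace Summit.Ventures.Crystal3D.Theorems

open Summit.Ventures.Crystal3D Finset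
open Literature.MathematicalPhysics.StatisticalMechanics (fccStacking)
open scoped InnerProductSpace

open scoped Classical in
/-- **The CENSUS-FREE multi-root in-plane count feeds the payers (co-axial twin cell, normal form).**  See the module
docstring. -/
theorem wordNet_twin_payers_ge_multi {δ : ℝ} (hg : KissingGap δ) (hc : KissingClassification δ)
    (L : EuclideanSpace ℝ (Fin 3) ≃ₗᵢ[ℝ] EuclideanSpace ℝ (Fin 3))
    (F : Bool → (EuclideanSpace ℝ (Fin 3) ≃ₗᵢ[ℝ] EuclideanSpace ℝ (Fin 3)))
    (hF : (F false = L ∧ F true = (ℝ ∙ EuclideanSpace.single (2 : Fin 3) (1 : ℝ)).reflection.trans L) ∨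
      (F false = (ℝ ∙ EuclideanSpace.single (2 : Fin 3) (1 : ℝ)).reflection.trans L ∧ F true = L))
    {n : EuclideanSpace ℝ (Fin 3)}
    (hn : n = L (EuclideanSpace.single (2 : Fin 3) (1 : ℝ)) ∨ n = -L (EuclideanSpace.single (2 : Fin 3) (1 : ℝ)))
    (s₁ s₂ : EuclideanSpace ℝ (Fin 3)) (X P₁ P₂ : Finset (EuclideanSpace ℝ (Fin 3))) (R₀ h ρ : ℝ)
    (hR₀ : 10 ≤ R₀) (hh : 0 ≤ h) (hρ : R₀ ≤ ρ)
    (hX : ∀ p ∈ X, ∀ q ∈ X, p ≠ q → 1 ≤ dist p q)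
    (hcell : ∀ p ∈ X, -(2 * R₀) ≤ p 2 ∧ p 2 ≤ h + 2 * R₀ ∧ p 0 ^ 2 + p 1 ^ 2 ≤ ρ ^ 2)
    (hP₁X : P₁ ⊆ X) (hP₂X : P₂ ⊆ X)
    (hP₁ : ∀ p, p ∈ P₁ ↔ (p ∈ (fun q => F false q + s₁) '' fccStacking 1 (Real.sqrt (2 / 3)) ∧
      -(2 * R₀) ≤ p 2 ∧ p 2 ≤ -R₀ ∧ p 0 ^ 2 + p 1 ^ 2 ≤ ρ ^ 2))
    (hP₂ : ∀ p, p ∈ P₂ ↔ (p ∈ (fun q => F true q + s₂) '' fccStacking 1 (Real.sqrt (2 / 3)) ∧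
      h + R₀ ≤ p 2 ∧ p 2 ≤ h + 2 * R₀ ∧ p 0 ^ 2 + p 1 ^ 2 ≤ ρ ^ 2)) :
    Real.sqrt 2 * (∑ r ∈ fccSlots.filter (fun r => ⟪F false r, n⟫_ℝ = 0 ∧ 0 < (F false r) 2), (F false r) 2) *
        Real.pi * ρ ^ 2 - 12 * (12 * Real.sqrt 2 * Real.pi + 36 * R₀ + 55440) * ρ ≤
      78 * ((X.filter fun z => (X.filter fun q => dist z q = 1).card ≤ 11 ∧
          -R₀ - 2 ≤ z 2 ∧ z 2 ≤ h + R₀ + 2).card : ℝ) := by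
  set e₃ : EuclideanSpace ℝ (Fin 3) := EuclideanSpace.single (2 : Fin 3) (1 : ℝ) with he₃
  set RT := fccSlots.filter (fun r => ⟪(F false) r, n⟫_ℝ = 0 ∧ 0 < ((F false) r) 2) with hRTdef
  have hRT : ∀ r ∈ RT, r ∈ fccSlots := fun r hr => (mem_filter.1 hr).1
  have hRTin : ∀ r ∈ RT, ⟪(F false) r, n⟫_ℝ = 0 := fun r hr => (mem_filter.1 hr).2.1
  have hRTup : ∀ r ∈ RT, 0 < ((F false) r) 2 := fun r hr => (mem_filter.1 hr).2.2
  have hRTcard : (RT.card : ℝ) ≤ 12 := by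
    have : RT.card ≤ 12 := (card_le_card (filter_subset _ _)).trans (by rw [card_fccSlots])
    exact_mod_cast this
  -- the axis: unit, and the menu of both frames along it
  have hn1 : ‖n‖ = 1 := by
    rcases hn with rfl | rfl
    · rw [LinearIsometryEquiv.norm_map, he₃, PiLp.norm_single, norm_one]
    · rw [norm_neg, LinearIsometryEquiv.norm_map, he₃, PiLp.norm_single, norm_one]
  have hax : ∀ c w, ⟪F c w, L e₃⟫_ℝ = w 2 := by
    intro c w
    rcases hF with ⟨h0, h1⟩ | ⟨h0, h1⟩ <;> cases c <;> simp only [h0, h1]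
    · exact inner_frame_axis L w
    · exact inner_twinFrame_axis L w
    · exact inner_twinFrame_axis L w
    · exact inner_frame_axis L w
  have haxn : ∀ c w, ⟪F c w, n⟫_ℝ = w 2 ∨ ⟪F c w, n⟫_ℝ = -w 2 := by
    intro c w
    rcases hn with rfl | rfl
    · exact Or.inl (hax c w)
    · exact Or.inr (by rw [inner_neg_right, hax])
  have hmenu : ∀ c, ∀ w ∈ fccSlots,
      ⟪F c w, n⟫_ℝ = 0 ∨ ⟪F c w, n⟫_ℝ = Real.sqrt (2 / 3) ∨ ⟪F c w, n⟫_ℝ = -Real.sqrt (2 / 3) := by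
    intro c w hw
    rcases haxn c w with h | h <;> rcases slot_apply_two_cases hw with h' | h' | h' <;> rw [h, h']
    · exact Or.inl rfl
    · exact Or.inr (Or.inl rfl)
    · exact Or.inr (Or.inr rfl)
    · exact Or.inl neg_zero
    · exact Or.inr (Or.inr rfl)
    · exact Or.inr (Or.inl (neg_neg _))
  have htrue : ∀ w, F true (-w) = F false w - (2 * ⟪F false w, n⟫_ℝ) • n := by
    intro w
    rcases hF with ⟨h0, h1⟩ | ⟨h0, h1⟩ <;> rw [h0, h1]
    · exact twinFrame_neg_eq L hn w
    · exact frame_neg_eq L hn w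
  have hr : 0 < Real.sqrt (2 / 3) := Real.sqrt_pos.2 (by norm_num)
  have hR₀3 : (3 : ℝ) ≤ R₀ := by linarith
  have hρ0 : (0 : ℝ) ≤ ρ := by linarith
  have hρ1 : (1 : ℝ) ≤ ρ := by linarith
  -- the word data over the bottom frame
  set Fw : List (EuclideanSpace ℝ (Fin 3)) → (EuclideanSpace ℝ (Fin 3) ≃ₗᵢ[ℝ] EuclideanSpace ℝ (Fin 3)) :=
    fun κ => κ.foldr (fun μ G => ((ℝ ∙ μ)ᗮ.reflection).trans G) (F false) with hFw
  set uw : EuclideanSpace ℝ (Fin 3) → List (EuclideanSpace ℝ (Fin 3)) → EuclideanSpace ℝ (Fin 3) :=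
    fun r κ => κ.foldr (fun _ v => -v) r with huw
  set WFw : EuclideanSpace ℝ (Fin 3) → List (EuclideanSpace ℝ (Fin 3)) → Prop := fun r κ =>
    List.rec (motive := fun _ => Prop) True (fun μ κ' ih => ih ∧ ‖μ‖ = 1 ∧
      (∀ w ∈ fccSlots, ⟪w, μ⟫_ℝ = 0 ∨ ⟪w, μ⟫_ℝ = Real.sqrt (2 / 3) ∨ ⟪w, μ⟫_ℝ = -Real.sqrt (2 / 3)) ∧
      ⟪uw r κ', μ⟫_ℝ = Real.sqrt (2 / 3) ∧ ∀ μ' κ'', κ' = μ' :: κ'' → μ' ≠ -μ) κ with hWFw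
  set nextw : List (EuclideanSpace ℝ (Fin 3)) → EuclideanSpace ℝ (Fin 3) → List (EuclideanSpace ℝ (Fin 3)) :=
    fun κ m => @ite _ (∃ μ κ', κ = μ :: κ' ∧ (Fw κ).symm m = -μ) (Classical.propDecidable _) κ.tail
      ((Fw κ).symm m :: κ) with hnextw
  have hF0 : Fw [] = (F false) := rfl
  have hFc : ∀ μ κ, Fw (μ :: κ) = ((ℝ ∙ μ)ᗮ.reflection).trans (Fw κ) := fun _ _ => rfl
  have hu0 : ∀ r, uw r [] = r := fun _ => rfl
  have huc : ∀ r μ κ, uw r (μ :: κ) = -uw r κ := fun _ _ _ => rfl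
  have hWF0 : ∀ r, WFw r [] := fun _ => trivial
  have hWFc : ∀ r μ κ, WFw r (μ :: κ) ↔ (WFw r κ ∧ ‖μ‖ = 1 ∧
      (∀ w ∈ fccSlots, ⟪w, μ⟫_ℝ = 0 ∨ ⟪w, μ⟫_ℝ = Real.sqrt (2 / 3) ∨ ⟪w, μ⟫_ℝ = -Real.sqrt (2 / 3)) ∧
      ⟪uw r κ, μ⟫_ℝ = Real.sqrt (2 / 3) ∧ ∀ μ' κ', κ = μ' :: κ' → μ' ≠ -μ) := fun _ _ _ => Iff.rfl
  have hnext_pop : ∀ μ κ' (m : EuclideanSpace ℝ (Fin 3)), (Fw (μ :: κ')).symm m = -μ → nextw (μ :: κ') m = κ' := by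
    intro μ κ' m hν
    simp only [hnextw]
    rw [if_pos ⟨μ, κ', rfl, hν⟩, List.tail_cons]
  have hnext_push : ∀ κ (m : EuclideanSpace ℝ (Fin 3)), (∀ μ κ', κ = μ :: κ' → (Fw κ).symm m ≠ -μ) →
      nextw κ m = (Fw κ).symm m :: κ := by
    intro κ m hnp
    simp only [hnextw]
    rw [if_neg]
    rintro ⟨μ, κ', h, hν⟩
    exact hnp μ κ' h hν
  clear_value nextw WFw uw Fw
  have hu : ∀ r ∈ RT, ∀ κ, uw r κ ∈ fccSlots := fun r hr => word_u_mem (hRT r hr) (hu0 r) (huc r)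
  -- the model lamination normal `ν₀ = (F false)⁻¹ n` and the top frame `Fw [ν₀] = R_n ∘ F false`
  set ν₀ : EuclideanSpace ℝ (Fin 3) := (Fw []).symm n with hν₀
  have hFν₀ : Fw [] ν₀ = n := by rw [hν₀, LinearIsometryEquiv.apply_symm_apply]
  have hν₀1 : ‖ν₀‖ = 1 := by rw [hν₀, LinearIsometryEquiv.norm_map, hn1]
  have hinner0 : ∀ x, ⟪x, ν₀⟫_ℝ = ⟪Fw [] x, n⟫_ℝ := by
    intro x; rw [← hFν₀, LinearIsometryEquiv.inner_map_map]
  have hν₀menu : ∀ w ∈ fccSlots, ⟪w, ν₀⟫_ℝ = 0 ∨ ⟪w, ν₀⟫_ℝ = Real.sqrt (2 / 3) ∨ ⟪w, ν₀⟫_ℝ = -Real.sqrt (2 / 3) := by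
    intro w hw; rw [hinner0, hF0]; exact hmenu false w hw
  have horth : ∀ r ∈ RT, ⟪uw r [], ν₀⟫_ℝ = 0 := by intro r hr; rw [hinner0, hF0, hu0]; exact hRTin r hr
  have hlamF : ∀ x, Fw [ν₀] x = F false x - (2 * ⟪F false x, n⟫_ℝ) • n := by
    intro x
    have := word_push_frame hFc [] hn1 x
    rw [hF0] at this
    rw [hν₀, hF0]
    exact this
  have hG₂ : ((Fw [ν₀] : EuclideanSpace ℝ (Fin 3) ≃ₗᵢ[ℝ] EuclideanSpace ℝ (Fin 3)) :
      EuclideanSpace ℝ (Fin 3) → EuclideanSpace ℝ (Fin 3)) '' ↑fccSlots =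
      (fun x => Fw [] (x - (2 * ⟪x, ν₀⟫_ℝ) • ν₀)) '' ↑fccSlots := by
    refine Set.image_congr fun x _ => ?_
    exact word_F_cons_apply hFc hν₀1 [] x
  have htrue' : ∀ y, F true y = Fw [ν₀] (-y) := by
    intro y
    rw [hlamF]
    have := htrue (-y)
    rw [neg_neg] at this
    exact this
  have hΛ₂ : (fun q => F true q + s₂) '' fccStacking 1 (Real.sqrt (2 / 3)) =
      (fun q => Fw [ν₀] q + s₂) '' fccStacking 1 (Real.sqrt (2 / 3)) := by
    ext p
    constructor
    · rintro ⟨q, hq, rfl⟩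
      exact ⟨-q, fcc_neg_mem hq, by simp only [htrue']⟩
    · rintro ⟨q, hq, rfl⟩
      refine ⟨-q, fcc_neg_mem hq, ?_⟩
      simp only [htrue', neg_neg]
  have hP₂' : ∀ p, p ∈ P₂ ↔ (p ∈ (fun q => Fw [ν₀] q + s₂) '' fccStacking 1 (Real.sqrt (2 / 3)) ∧
      h + R₀ ≤ p 2 ∧ p 2 ≤ h + 2 * R₀ ∧ p 0 ^ 2 + p 1 ^ 2 ≤ ρ ^ 2) := by
    intro p; rw [hP₂, hΛ₂]
  -- no word of any in-plane root family carries a triangle of the top frame (`word_noTop_of_inner_zero`)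
  have hPexcl0 : ∀ r ∈ RT, ∀ (b : EuclideanSpace ℝ (Fin 3)) (κ : List (EuclideanSpace ℝ (Fin 3))), WFw r κ →
      (fun _ : EuclideanSpace ℝ (Fin 3) × List (EuclideanSpace ℝ (Fin 3)) => True) (b, κ) → b ∈ P₂ →
      (∀ w ∈ fccSlots, b + Fw [ν₀] w ∈ X) →
      (∃ a ∈ fccSlots, ∃ a' ∈ fccSlots, ∃ a'' ∈ fccSlots,
        ⟪a, a'⟫_ℝ = 1 / 2 ∧ ⟪a, a''⟫_ℝ = 1 / 2 ∧ ⟪a', a''⟫_ℝ = 1 / 2 ∧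
        b + Fw κ a ∈ X ∧ b + Fw κ a' ∈ X ∧ b + Fw κ a'' ∈ X) → False := by
    intro r hr b κ hκ _ _ hGfull htri
    obtain ⟨a, ha, a', ha', a'', ha'', i1, i2, i3, h1, h2, h3⟩ := htri
    refine word_noTop_of_inner_zero hFc (huc r) (hWFc r) hν₀1 hν₀menu (horth r hr) (Fw [ν₀]) hG₂ hκ
      ⟨a, ha, a', ha', a'', ha'', i1, i2, i3, ?_, ?_, ?_⟩
    · exact shell_slot_of_full hX (Fw [ν₀]) hGfull h1 (by rw [LinearIsometryEquiv.norm_map, norm_eq_one_of_mem_fccSlots ha])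
    · exact shell_slot_of_full hX (Fw [ν₀]) hGfull h2 (by rw [LinearIsometryEquiv.norm_map, norm_eq_one_of_mem_fccSlots ha'])
    · exact shell_slot_of_full hX (Fw [ν₀]) hGfull h3 (by rw [LinearIsometryEquiv.norm_map, norm_eq_one_of_mem_fccSlots ha''])
  -- the inner sample
  set zcut : ℝ := h + R₀ + 1 with hzcut
  set P' : Finset (EuclideanSpace ℝ (Fin 3)) := P₁.filter fun p =>
    -(2 * R₀) + 1 ≤ p 2 ∧ p 2 ≤ -R₀ - 1 ∧ p 0 ^ 2 + p 1 ^ 2 ≤ (ρ - 1) ^ 2 with hP'def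
  have hP'iff : ∀ p, p ∈ P' ↔ (p ∈ (fun q => (F false) q + s₁) '' fccStacking 1 (Real.sqrt (2 / 3)) ∧
      -(2 * R₀) + 1 ≤ p 2 ∧ p 2 ≤ -R₀ - 1 ∧ p 0 ^ 2 + p 1 ^ 2 ≤ (ρ - 1) ^ 2) := by
    intro p
    rw [hP'def, mem_filter, hP₁]
    constructor
    · rintro ⟨⟨hΛ, -, -, -⟩, h1, h2, h3⟩; exact ⟨hΛ, h1, h2, h3⟩
    · rintro ⟨hΛ, h1, h2, h3⟩
      have hρ1' : (0 : ℝ) ≤ ρ - 1 := by linarith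
      exact ⟨⟨hΛ, by linarith, by linarith, by nlinarith⟩, h1, h2, h3⟩
  -- the inner sample has full shells (complete sample)
  have hP'full : ∀ p ∈ P', ∀ w ∈ fccSlots, p + Fw [] w ∈ X := by
    intro p hp w hw
    rw [hF0]
    obtain ⟨hΛ, h1, h2, h3⟩ := (hP'iff p).1 hp
    apply hP₁X
    rw [hP₁]
    have hw2 : |((F false) w) 2| ≤ 1 := by rw [apply_two_eq_inner_e₃]; exact abs_inner_slot_le_one (F false) hw
    obtain ⟨hw2a, hw2b⟩ := abs_le.1 hw2
    refine ⟨movedFcc_add_site_mem (F false) s₁ hΛ (mem_fcc_of_mem_fccSlots hw), ?_, ?_, ?_⟩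
    · show -(2 * R₀) ≤ (p + (F false) w) 2
      rw [PiLp.add_apply]; linarith
    · show (p + (F false) w) 2 ≤ -R₀
      rw [PiLp.add_apply]; linarith
    · show (p + (F false) w) 0 ^ 2 + (p + (F false) w) 1 ^ 2 ≤ ρ ^ 2
      have hρ1' : (0 : ℝ) ≤ ρ - 1 := by linarith
      have hsl : Real.sqrt (p 0 ^ 2 + p 1 ^ 2) ≤ ρ - 1 := by
        rw [← Real.sqrt_sq hρ1']; exact Real.sqrt_le_sqrt h3
      have e1 := sqrt_lateral_add_le p ((F false) w)
      rw [LinearIsometryEquiv.norm_map, norm_eq_one_of_mem_fccSlots hw] at e1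
      have e3 : Real.sqrt ((p + (F false) w) 0 ^ 2 + (p + (F false) w) 1 ^ 2) ≤ ρ := by linarith
      have e4 := Real.sq_sqrt (by positivity : (0 : ℝ) ≤ (p + (F false) w) 0 ^ 2 + (p + (F false) w) 1 ^ 2)
      have e5 : (0 : ℝ) ≤ Real.sqrt ((p + (F false) w) 0 ^ 2 + (p + (F false) w) 1 ^ 2) := Real.sqrt_nonneg _
      nlinarith
  -- (1) the multi-root NET count of the word automaton
  have hP₁' : ∀ p, p ∈ P₁ ↔ (p ∈ (fun q => Fw [] q + s₁) '' fccStacking 1 (Real.sqrt (2 / 3)) ∧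
      -(2 * R₀) ≤ p 2 ∧ p 2 ≤ -R₀ ∧ p 0 ^ 2 + p 1 ^ 2 ≤ ρ ^ 2) := by rw [hF0]; exact hP₁
  have hP'iff' : ∀ p, p ∈ P' ↔ (p ∈ (fun q => Fw [] q + s₁) '' fccStacking 1 (Real.sqrt (2 / 3)) ∧
      -(2 * R₀) + 1 ≤ p 2 ∧ p 2 ≤ -R₀ - 1 ∧ p 0 ^ 2 + p 1 ^ 2 ≤ (ρ - 1) ^ 2) := by rw [hF0]; exact hP'iff
  have hup : ∀ r ∈ RT, 0 < (Fw [] r) 2 := by intro r hr; rw [hF0]; exact hRTup r hr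
  have hcore := word_sources_le_lists_payers_multiExcl (F := Fw) (u := uw) (WF := WFw) (next := nextw)
    (t₁ := s₁) (t₂ := s₂) (P := fun _ => True) hg hc hX hFc RT hRT (fun r _ => hu0 r) (fun r _ => huc r)
    (fun r _ => hWF0 r) (fun r _ => hWFc r) hnext_pop hnext_push (Fw [ν₀]) (fun _ _ _ _ _ _ => trivial)
    (fun _ _ _ _ _ _ _ _ => trivial) hPexcl0 hup hR₀3 hρ hcell hP₁X hP₂X hP₁' hP'iff' hP'full
    (fun _ _ _ _ => trivial) hP₂'
  rw [hF0] at hcore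
  -- (2) the sources, per root
  have hsources : ∀ r ∈ RT, Real.sqrt 2 * ((F false) r) 2 * Real.pi * (ρ - 1) ^ 2 -
        10 * Real.sqrt 2 * Real.pi * (ρ - 1) - 36 * R₀ * ρ ≤
      ((P'.filter fun p => (∀ w ∈ fccSlots, p + (F false) w ∈ X) ∧
          -R₀ - 1 < (p + (F false) r) 2 ∧ (p + (F false) r) 2 < zcut).card : ℝ) := by
    intro r hr
    have key := card_vertical_tops_ge (F false) s₁ X P₁ P' R₀ ρ zcut hR₀3 hρ (by rw [hzcut]; linarith)
      hX hP₁X hP₁ hP'iff (hRT r hr) (by rw [← apply_two_eq_inner_e₃]; exact (hRTup r hr).le)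
    rw [← apply_two_eq_inner_e₃, abs_of_pos (hRTup r hr)] at key
    exact key
  -- (3) the rims
  set RIMT := X.filter fun s => zcut ≤ s 2 ∧ s 2 ≤ zcut + 1 ∧ (ρ - 2) ^ 2 < s 0 ^ 2 + s 1 ^ 2 with hRIMT
  have hrimT : (RIMT.card : ℝ) ≤ 144 * ρ := by
    have hsep : ∀ p ∈ RIMT, ∀ q ∈ RIMT, p ≠ q → 1 ≤ dist p q :=
      fun p hp q hq hpq => hX p (mem_filter.1 hp).1 q (mem_filter.1 hq).1 hpq
    have hmem : ∀ p ∈ RIMT, zcut ≤ p 2 ∧ p 2 ≤ zcut + 1 ∧ (ρ - 2) ^ 2 < p 0 ^ 2 + p 1 ^ 2 ∧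
        p 0 ^ 2 + p 1 ^ 2 ≤ ρ ^ 2 := by
      intro p hp
      obtain ⟨hpX, h1, h2, h3⟩ := mem_filter.1 hp
      exact ⟨h1, h2, h3, (hcell p hpX).2.2⟩
    have key := card_mul_le_of_separated_in_shell RIMT hsep zcut (zcut + 1) (ρ - 2) ρ (by linarith)
      (by linarith) (by linarith) hmem
    have e : (zcut + 1 - zcut + 2) * (Real.pi * (ρ + 1) ^ 2 - Real.pi * (ρ - 2 - 1) ^ 2) =
        (Real.pi / 6) * (144 * ρ - 144) := by ring
    rw [e] at key
    have hπ : 0 < Real.pi / 6 := by positivity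
    have := le_of_mul_le_mul_right (by linarith [key] : (RIMT.card : ℝ) * (Real.pi / 6) ≤
      (144 * ρ - 144) * (Real.pi / 6)) hπ
    linarith
  set RIMB := X.filter fun s => -R₀ - 1 - 1 ≤ s 2 ∧ s 2 < -R₀ - 1 ∧ (ρ - 1) ^ 2 < s 0 ^ 2 + s 1 ^ 2 with hRIMB
  have hrimB : (RIMB.card : ℝ) ≤ 108 * ρ := by
    have hsep : ∀ p ∈ RIMB, ∀ q ∈ RIMB, p ≠ q → 1 ≤ dist p q :=
      fun p hp q hq hpq => hX p (mem_filter.1 hp).1 q (mem_filter.1 hq).1 hpq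
    have hmem : ∀ p ∈ RIMB, -R₀ - 1 - 1 ≤ p 2 ∧ p 2 ≤ -R₀ - 1 ∧ (ρ - 1) ^ 2 < p 0 ^ 2 + p 1 ^ 2 ∧
        p 0 ^ 2 + p 1 ^ 2 ≤ ρ ^ 2 := by
      intro p hp
      obtain ⟨hpX, h1, h2, h3⟩ := mem_filter.1 hp
      exact ⟨h1, h2.le, h3, (hcell p hpX).2.2⟩
    have key := card_mul_le_of_separated_in_shell RIMB hsep (-R₀ - 1 - 1) (-R₀ - 1) (ρ - 1) ρ (by linarith)
      (by linarith) (by linarith) hmem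
    have e : (-R₀ - 1 - (-R₀ - 1 - 1) + 2) * (Real.pi * (ρ + 1) ^ 2 - Real.pi * (ρ - 1 - 1) ^ 2) =
        (Real.pi / 6) * (108 * ρ - 54) := by ring
    rw [e] at key
    have hπ : 0 < Real.pi / 6 := by positivity
    have := le_of_mul_le_mul_right (by linarith [key] : (RIMB.card : ℝ) * (Real.pi / 6) ≤
      (108 * ρ - 54) * (Real.pi / 6)) hπ
    linarith
  -- (4) arithmetic
  set PAY := X.filter fun z => (X.filter fun q => dist z q = 1).card ≤ 11 ∧ -R₀ - 2 ≤ z 2 ∧ z 2 ≤ h + R₀ + 2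
    with hPAY
  have hPAYeq : (X.filter fun z => (X.filter fun q => dist z q = 1).card ≤ 11 ∧
      -R₀ - 1 - 1 ≤ z 2 ∧ z 2 ≤ h + R₀ + 1 + 1) = PAY := by
    refine filter_congr fun z _ => ?_
    rw [show -R₀ - 1 - 1 = -R₀ - 2 by ring, show h + R₀ + 1 + 1 = h + R₀ + 2 by ring]
  rw [hPAYeq] at hcore
  -- the core count, cast to `ℝ`
  have hcast : ((∑ r ∈ RT, (P'.filter fun p => (∀ w ∈ fccSlots, p + (F false) w ∈ X) ∧
      -R₀ - 1 < (p + (F false) r) 2 ∧ (p + (F false) r) 2 < zcut).card : ℕ) : ℝ) ≤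
      78 * (PAY.card : ℝ) + (RT.card : ℝ) * (220 * (RIMT.card : ℝ) + 220 * (RIMB.card : ℝ)) := by
    have h0 : ∑ r ∈ RT, (P'.filter fun p => (∀ w ∈ fccSlots, p + (F false) w ∈ X) ∧
        -R₀ - 1 < (p + (F false) r) 2 ∧ (p + (F false) r) 2 < zcut).card ≤
        78 * PAY.card + RT.card * (220 * RIMT.card + 220 * RIMB.card) := hcore
    exact_mod_cast h0
  rw [Nat.cast_sum] at hcast
  -- per root: the source bound in the form `√2 α π ρ² − (12√2π + 36R₀) ρ ≤ #sources_r`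
  have h2 : 0 ≤ Real.sqrt 2 := Real.sqrt_nonneg _
  have hπ : 0 ≤ Real.pi := Real.pi_pos.le
  have h2π : 0 ≤ Real.sqrt 2 * Real.pi * ρ := mul_nonneg (mul_nonneg h2 hπ) hρ0
  have hper : ∀ r ∈ RT, Real.sqrt 2 * ((F false) r) 2 * Real.pi * ρ ^ 2 - (12 * Real.sqrt 2 * Real.pi + 36 * R₀) * ρ ≤
      ((P'.filter fun p => (∀ w ∈ fccSlots, p + (F false) w ∈ X) ∧
          -R₀ - 1 < (p + (F false) r) 2 ∧ (p + (F false) r) 2 < zcut).card : ℝ) := by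
    intro r hr
    have hs := hsources r hr
    set α := ((F false) r) 2 with hα
    have hα0 : 0 ≤ α := (hRTup r hr).le
    have hαle : α ≤ 1 := by
      have := abs_inner_slot_le_one (F false) (hRT r hr)
      rw [← apply_two_eq_inner_e₃] at this
      exact (abs_le.1 this).2
    have hsq : Real.sqrt 2 * α * Real.pi * (ρ - 1) ^ 2 ≥ Real.sqrt 2 * α * Real.pi * ρ ^ 2 - 2 * Real.sqrt 2 * Real.pi * ρ := by
      have e : Real.sqrt 2 * α * Real.pi * (ρ - 1) ^ 2 = Real.sqrt 2 * α * Real.pi * ρ ^ 2 -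
          2 * Real.sqrt 2 * α * Real.pi * ρ + Real.sqrt 2 * α * Real.pi := by ring
      rw [e]
      have h1 : Real.sqrt 2 * α * Real.pi * ρ ≤ Real.sqrt 2 * Real.pi * ρ := by
        have := mul_le_mul_of_nonneg_left hαle h2π
        have e1 : Real.sqrt 2 * α * Real.pi * ρ = Real.sqrt 2 * Real.pi * ρ * α := by ring
        rw [mul_one] at this; rw [e1]; exact this
      have h3 : 0 ≤ Real.sqrt 2 * α * Real.pi := mul_nonneg (mul_nonneg h2 hα0) hπ
      linarith
    have h10 : 10 * Real.sqrt 2 * Real.pi * (ρ - 1) ≤ 10 * Real.sqrt 2 * Real.pi * ρ := by nlinarith only [h2π, h2, hπ]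
    linarith only [hs, hsq, h10, h2π]
  have hsum := sum_le_sum hper
  rw [sum_sub_distrib, sum_const, nsmul_eq_mul, ← sum_mul, ← sum_mul, ← mul_sum] at hsum
  -- collect: the rims and the per-root losses are at most `12 · (12√2π + 36R₀ + 55440) ρ`
  have hK0 : 0 ≤ (12 * Real.sqrt 2 * Real.pi + 36 * R₀ + 55440) * ρ := by
    have : 0 ≤ 12 * Real.sqrt 2 * Real.pi + 36 * R₀ + 55440 := by positivity
    exact mul_nonneg this hρ0
  have hloss : (RT.card : ℝ) * ((12 * Real.sqrt 2 * Real.pi + 36 * R₀) * ρ) +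
      (RT.card : ℝ) * (220 * (RIMT.card : ℝ) + 220 * (RIMB.card : ℝ)) ≤
      12 * (12 * Real.sqrt 2 * Real.pi + 36 * R₀ + 55440) * ρ := by
    have hrims : 220 * (RIMT.card : ℝ) + 220 * (RIMB.card : ℝ) ≤ 55440 * ρ := by linarith [hrimT, hrimB]
    have hc0 : (0 : ℝ) ≤ RT.card := Nat.cast_nonneg _
    have h1 : (RT.card : ℝ) * ((12 * Real.sqrt 2 * Real.pi + 36 * R₀) * ρ) +
        (RT.card : ℝ) * (220 * (RIMT.card : ℝ) + 220 * (RIMB.card : ℝ)) ≤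
        (RT.card : ℝ) * ((12 * Real.sqrt 2 * Real.pi + 36 * R₀ + 55440) * ρ) := by
      have := mul_le_mul_of_nonneg_left hrims hc0
      nlinarith only [this]
    have h2 := mul_le_mul_of_nonneg_right hRTcard hK0
    linarith only [h1, h2]
  linarith only [hcast, hsum, hloss]

end Summit.Ventures.Crystal3D.Theorems

end
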